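import Literature.AlgebraicGeometry.Motives.HodgeThetaSubalgebraPerfect
import Literature.RepresentationTheory.GeneralLinear.Sl2ProductGluedSubalgebras
import HarnessLib

/-!
# Rational Lie algebras containing the Hodge operator, on a weight-one Hodge structure split into REAL two-dimensional blocks that may be LINKED by Hodge endomorphisms: `𝔤_ℂ = ⊕_{classes} 𝔰𝔩₂` glued along the links (Hazama 1983 §3 «the i-th component acts on `V_i ⊕ ⋯ ⊕ V_i` diagonally»; Moonen–Zarhin 1999 (2.2) Type 2(1); V. K. Murty 1988 Thm. 2, `m = 1`)

Family `hodge`, layer `Literature/AlgebraicGeometry/Motives` (abstract polarizable `ℚ`-Hodge structures; no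
geometry). Research context: cell `pub-hodge-ring2` (HONEST FRAMING: research route conditional on HC_CM; not a
corollary; Q11.4-sentence-2 already refuted in dim ≥ 3), Literature lane, programme R6 = V. Kumar Murty 1988
Thm. 2 in the case `m = 1` (complex abelian varieties whose `End⁰` contains a totally real number field `K` as
its own commutant with `[K:ℚ] = dim A`; beyond `End⁰(A) = K` — the tree's `HodgeThetaSubalgebraRealPlacesSl2`,
Hazama 1983 / Ribet 1983 — this is the TYPE II minimal case, `End⁰(A)` a totally indefinite quaternion algebra:
Moonen–Zarhin 1999 (2.2) «Type 2(1): `Hg = U_{D^opp}`, `V_ℂ = W ⊗ ℂ²`»). UNCONDITIONAL linear algebra,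
theorems only plus no definition and no named fact (D-0026); no step towards a summit statement.

SETTING. `H` an effective polarizable `ℚ`-Hodge structure of weight `1` on a finite-dimensional `V`, `ψ` a
polarization, `Θ` a Hodge operator (`2p - 1` on `V^{p,1-p}`), and an internal decomposition
`V_ℂ = ⊕_{i ∈ ι} T_i` into TWO-DIMENSIONAL blocks which are
* REAL: `conj T_i = T_i` (`hconjT`);
* preserved by every rational operator commuting with `E = End_Hdg(V)` (`hTE`; e.g. the joint eigenspaces of a
  commutative subalgebra `θ(K) ⊆ E`);
* SEPARATED BY `E` ONLY THROUGH SCALARS: an element of `E ⊗ ℂ` preserving every block is a scalar on each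
  block (`hscal`; for `K`-eigenblocks this is «`θ(K)` is its own commutant in `E`», Murty's «maximal commutative
  subalgebra»);
and `E` has NO `ψ`-skew central element (`hE`: Moonen–Zarhin's «no factor of type IV», the tree's
`HodgeTheory.HasNoTypeIVFactor` read on `H¹`). An ADMISSIBLE algebra is a bracket-closed `ℚ`-subspace
`𝔤 ⊆ End_ℚ(V)` of `ψ`-skew operators commuting with `E` with `Θ ∈ 𝔤_ℂ` (`Lie Hg`, or the annihilator `𝔞(q)`
of a rational Hodge tensor, `HodgeThetaAnnihilatorLieAlgebra.annLie`).

WHAT IS NEW compared with `HodgeThetaSubalgebraRealPlacesSl2` (where the blocks are the eigenblocks of the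
characters of a COMMUTATIVE `E`, pairwise non-isomorphic `𝔤`-modules, and `𝔤_ℂ = ⊕_i 𝔰𝔩(T_i)`): here
`E ⊗ ℂ` may LINK two blocks `T_i ≅ T_k` (e.g. the matrix units of `D ⊗ ℂ ≅ M₂(ℂ)` swap the two eigenlines of
a maximal subfield `K ⊂ D`), and then `𝔤_ℂ` acts on `T_i ⊕ T_k` through ONE `𝔰𝔩₂` — Hazama 1983 §3 (p. 306):
«`𝔥 = 𝔰𝔩₂ × ⋯ × 𝔰𝔩₂` (k-times) where the i-th component `𝔰𝔩₂` acts on `V_i ⊕ ⋯ ⊕ V_i` diagonally».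

MAIN THEOREM `GluedBlocks.exists_glued_adapted_blockBasis`. There are a class map `cls : ι → ι` and block bases
`b'_i = (b'_i 0 ∈ V^{1,0}, b'_i 1 ∈ V^{0,1})` ADAPTED to the Hodge decomposition and GLUED along the classes,
such that for EVERY admissible `𝔤`: (1) the blocks of every `Y ∈ 𝔤_ℂ` are trace-free; (2) blocks of `Y ∈ 𝔤_ℂ`
in the same class coincide: `blockMat b' Y k = blockMat b' Y k'` if `cls k = cls k'`; (3) conversely, for every
`i` and every trace-free `N`, the operator which is `N` (in the bases `b'`) on the blocks of the class of `i` and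
`0` on the others lies in `𝔤_ℂ`. So `𝔤_ℂ = ⊕_{classes} 𝔰𝔩₂(ℂ)` diagonally embedded — for every admissible `𝔤`,
with the SAME classes and bases (the classes are those of the conjugacy relation of the maximal admissible
algebra `𝔰𝔭_E(V, ψ)`; every admissible `𝔤` has the same ones).

PROOF. Blockwise trace-freeness from PERFECTNESS (`eq_span_commutators_of_forall_central_skew_eq_zero`,
Deligne I 3.6 / Moonen–Zarhin §1, the tree's `HodgeThetaSubalgebraPerfect`) instead of `ψ`-orthogonality of
the blocks (no self-adjointness of `E` is assumed); per block, fullness `p_i(𝔤_ℂ) = 𝔰𝔩(T_i)` by the tree's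
trichotomy (`Sl2RationalSubalgebraTrichotomy`) fed with (i) «`J_i = Θ|_{T_i}` has no real eigenline» (odd weight)
and (a) «two elements with non-commuting `i`-blocks» (else `Θ|_{T_i} ⊕ 0` commutes with `𝔤`, lies in `E ⊗ ℂ`,
preserves the blocks, hence is a scalar on `T_i` by `hscal` — absurd); then GOURSAT WITH CLASSES
(`Sl2ProductGluedSubalgebras.exists_mem_span_apply_eq_of_places`) in REAL block bases; conjugate blocks are
linked by an intertwiner commuting with `𝔤`, hence in `E ⊗ ℂ` (`ThetaSubalgebra.mem_span_endAlg_of_forall_commute`),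
hence Hodge — transporting an adapted basis of one block of each class to the others gives the glued adapted
bases; the conjugacy relation is the same for all admissible `𝔤` (an intertwiner in `E ⊗ ℂ` commutes with
`𝔰𝔭_E(V, ψ) ⊇ 𝔤`).

CONSUMER. The geometric sequel (`HodgeTheory/TotallyRealMaxSubfield…`) feeds `T` = the eigenblocks of a totally
real self-commutant `K ⊆ End⁰(A)` with `[K:ℚ] = dim A` and runs the colourwise first fundamental theorem for
`SL₂` with colour = class, proving `B•(Aⁿ) = D•(Aⁿ)` (Murty 1988 Thm. 2, `m = 1`) fact-free.

## References

* [Hazama1983] F. Hazama, *Algebraic cycles on abelian varieties with many real endomorphisms*, Tôhoku Math.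
  J. 35 (1983) 303–308 (held `paper:doi-10-2748-tmj-1178229056`): Thm. (1.1), Prop. (2.6), Lemma (3.1), §3
  pp. 305–306. [cite: Hazama1983, Thm. (1.1), Prop. (2.6), Lemma (3.1) and §3 (pp. 305–306)]
* [MoonenZarhin1999LowDim] B. Moonen, Yu. Zarhin, Math. Ann. 315 (1999) 711–733 (held `paper:arxiv-math_9901113`):
  §1, (2.2) Type 2(1), §3 (3.1). [cite: MoonenZarhin1999LowDim, §1, (2.2) and §3 (3.1)]
* [Murty1988] V. Kumar Murty, *The Hodge group of an abelian variety*, Proc. AMS 104 (1988) 61–68, Thm. 2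
  (p. 67) and p. 66 («the case `m = 1`»). [cite: Murty1988, Thm. 2 (p. 67)]
* [Deligne1982HodgeCycles] P. Deligne, LNM 900 (1982), I §3 Prop. 3.4, Prop. 3.6. [cite: Deligne1982HodgeCycles, I §3 Prop. 3.4 and 3.6]
* [Zarhin1983HodgeGroupsK3] Yu. G. Zarhin, J. reine angew. Math. 341 (1983), §2. [cite: Zarhin1983HodgeGroupsK3, §2]
* [DeligneHodgeII1971] P. Deligne, *Théorie de Hodge II*, Publ. IHÉS 40 (1971), 2.1.4. [cite: DeligneHodgeII1971, 2.1.4]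
-/

noncomputable section

open scoped TensorProduct

namespace Literature.AlgebraicGeometry.Motives

namespace HodgeStructure

open RealPlaces Literature.RepresentationTheory.GeneralLinear

/-! ### §1 Blocks in two basis families; blocks of commuting intertwiners; vanishing blocks -/

section Generic

variable {K : Type*} [Field K] {W : Type*} [AddCommGroup W] [Module K W]
variable {ι : Type*} [Fintype ι] [DecidableEq ι] {T : ι → Submodule K W}
  (hint : DirectSum.IsInternal T) (b : ∀ i, Module.Basis (Fin 2) K (T i))

omit [Fintype ι] [DecidableEq ι] in
/-- Coordinates of an element of one block along its basis. [folklore] -/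
private theorem GluedBlocks.eq_sum_repr (b : ∀ i, Module.Basis (Fin 2) K (T i)) {k : ι} {x : W}
    (hx : x ∈ T k) : x = ∑ c, (b k).repr ⟨x, hx⟩ c • (b k c : W) := by
  conv_lhs => rw [show x = ((⟨x, hx⟩ : T k) : W) from rfl, ← (b k).sum_repr ⟨x, hx⟩]
  simp only [Submodule.coe_sum, Submodule.coe_smul]

/-- **The `k`-th block is the matrix of the restriction** of a block-preserving operator to `T_k` in the
block basis (Hazama's `p_k : End V → End V_k`). [cite: Hazama1983, §3 (p. 305)] -/
theorem GluedBlocks.blockMat_eq_toMatrix_restrict {f : Module.End K W} (hf : ∀ i, Set.MapsTo f (T i) (T i))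
    (k : ι) : blockMat hint b f k =
      LinearMap.toMatrix (b k) (b k) (f.restrict (p := T k) (q := T k) fun _ hx => hf k hx) := by
  ext a c
  rw [blockMat_apply_of_mapsTo hint b hf, LinearMap.toMatrix_apply, LinearMap.restrict_apply]

/-- **Change of block bases**: the blocks in a second basis family `b'` are the conjugates
`Q_k (blockMat_b f)_k Q_k⁻¹`, `Q_k = ` the transition matrix (`Q_k Q'_k = 1 = Q'_k Q_k`).
[cite: Hazama1983, §3 (p. 305)] -/
theorem GluedBlocks.blockMat_eq_conj_blockMat (b' : ∀ i, Module.Basis (Fin 2) K (T i)) {f : Module.End K W}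
    (hf : ∀ i, Set.MapsTo f (T i) (T i)) (k : ι) :
    blockMat hint b' f k = (b' k).toMatrix (b k) * blockMat hint b f k * (b k).toMatrix (b' k) := by
  rw [GluedBlocks.blockMat_eq_toMatrix_restrict hint b hf, GluedBlocks.blockMat_eq_toMatrix_restrict hint b' hf,
    basis_toMatrix_mul_linearMap_toMatrix_mul_basis_toMatrix]

omit [Fintype ι] [DecidableEq ι] in
/-- The transition matrices are mutually inverse. [folklore] -/
private theorem GluedBlocks.toMatrix_mul_toMatrix (b' : ∀ i, Module.Basis (Fin 2) K (T i)) (k : ι) :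
    (b' k).toMatrix (b k) * (b k).toMatrix (b' k) = 1 :=
  (b' k).toMatrix_mul_toMatrix_flip (b k)

/-- **A block-preserving operator vanishing on a block has zero block there**, in any block basis.
[cite: Hazama1983, §3 (p. 305)] -/
theorem GluedBlocks.blockMat_eq_zero_of_forall_apply {f : Module.End K W} (hf : ∀ i, Set.MapsTo f (T i) (T i))
    {k : ι} (h0 : ∀ x ∈ T k, f x = 0) : blockMat hint b f k = 0 := by
  ext a c
  rw [blockMat_apply_of_mapsTo hint b hf, Matrix.zero_apply]
  have h : (⟨f (b k c), hf k (b k c).2⟩ : T k) = 0 := Subtype.ext (h0 _ (b k c).2)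
  rw [h, map_zero, Finsupp.zero_apply]

/-- **Conversely a zero block means the operator vanishes on the block.** [cite: Hazama1983, §3 (p. 305)] -/
theorem GluedBlocks.apply_eq_zero_of_blockMat_eq_zero {f : Module.End K W} (hf : ∀ i, Set.MapsTo f (T i) (T i))
    {k : ι} (h0 : blockMat hint b f k = 0) {x : W} (hx : x ∈ T k) : f x = 0 := by
  rw [GluedBlocks.eq_sum_repr b hx, map_sum]
  refine Finset.sum_eq_zero fun c _ => ?_
  rw [map_smul, apply_basis_eq_sum hint b hf k c]
  simp only [h0, Matrix.zero_apply, zero_smul, Finset.sum_const_zero, smul_zero]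

/-- **Blocks of an operator commuting with an intertwiner are intertwined**: if `T_g f = f T_g` for the
intertwiner `T_g : T_k → T_i` of a matrix `g`, then `(blockMat f)_i g = g (blockMat f)_k` (the converse of
the tree's `intertwiner_comm`; Hazama 1983 Lemma (3.1): isomorphic `𝔥`-modules give graph position).
[cite: Hazama1983, Lemma (3.1) and §3 (p. 306)] -/
theorem GluedBlocks.blockMat_mul_eq_mul_blockMat_of_comm (i k : ι) (g : Matrix (Fin 2) (Fin 2) K)
    {f : Module.End K W} (hf : ∀ j, Set.MapsTo f (T j) (T j))
    (h : intertwiner hint b i k g * f = f * intertwiner hint b i k g) :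
    blockMat hint b f i * g = g * blockMat hint b f k := by
  have hli : LinearIndependent K fun a => (b i a : W) :=
    (b i).linearIndependent.map' (T i).subtype (Submodule.ker_subtype _)
  ext a c
  -- evaluate both sides of `T_g f = f T_g` on `b k c` and read the coefficient of `b i a`
  have h1 := LinearMap.congr_fun h (b k c : W)
  rw [Module.End.mul_apply, Module.End.mul_apply, apply_basis_eq_sum hint b hf k c, map_sum,
    intertwiner_apply_same, map_sum] at h1
  simp_rw [map_smul, intertwiner_apply_same, apply_basis_eq_sum hint b hf i] at h1
  -- both sides as a single combination of the `b i a`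
  have hL : ∑ d, blockMat hint b f k d c • ∑ a', g a' d • (b i a' : W) =
      ∑ a', (∑ d, g a' d * blockMat hint b f k d c) • (b i a' : W) := by
    simp_rw [Finset.smul_sum, smul_smul]
    rw [Finset.sum_comm]
    refine Finset.sum_congr rfl fun a' _ => ?_
    rw [Finset.sum_smul]
    exact Finset.sum_congr rfl fun d _ => by rw [mul_comm]
  have hR : ∑ d, g d c • ∑ a', blockMat hint b f i a' d • (b i a' : W) =
      ∑ a', (∑ d, blockMat hint b f i a' d * g d c) • (b i a' : W) := by
    simp_rw [Finset.smul_sum, smul_smul]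
    rw [Finset.sum_comm]
    refine Finset.sum_congr rfl fun a' _ => ?_
    rw [Finset.sum_smul]
    exact Finset.sum_congr rfl fun d _ => by rw [mul_comm]
  rw [hL, hR] at h1
  have h2 := sub_eq_zero.2 h1
  rw [← Finset.sum_sub_distrib] at h2
  simp_rw [← sub_smul] at h2
  have h3 := Fintype.linearIndependent_iff.1 hli _ h2 a
  rw [Matrix.mul_apply, Matrix.mul_apply]
  exact (sub_eq_zero.1 h3).symm

/-- **Traces of blocks of a commutator vanish** (`tr (M N - N M) = 0` blockwise for block-preserving
operators; Hazama 1983 §3: `p_i` is a Lie algebra homomorphism). [cite: Hazama1983, §3 (p. 305)] -/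
theorem GluedBlocks.trace_blockMat_commutator {f g : Module.End K W}
    (hf : ∀ i, Set.MapsTo f (T i) (T i)) (hg : ∀ i, Set.MapsTo g (T i) (T i)) (k : ι) :
    (blockMat hint b (f * g - g * f) k).trace = 0 := by
  rw [map_sub, blockMat_mul hint b hf hg, blockMat_mul hint b hg hf, Pi.sub_apply, Pi.mul_apply, Pi.mul_apply,
    Matrix.trace_sub, Matrix.trace_mul_comm, sub_self]

end Generic

/-! ### §2 Real bases, Hodge-adapted bases, and the Hodge operator on real two-dimensional blocks -/

section RealAdapted

universe u

variable {V : Type u} [AddCommGroup V] [Module ℚ V] [Module.Finite ℚ V] [HodgeTensorFacts.{u, u}] {n : ℤ}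
variable {ι : Type*} [Fintype ι] [DecidableEq ι] {T : ι → Submodule ℂ (ℂ ⊗[ℚ] V)}

omit [Module.Finite ℚ V] [HodgeTensorFacts.{u, u}] [Fintype ι] [DecidableEq ι] in
/-- **Real blocks have real bases**: a `conj`-stable two-dimensional block has a basis of real vectors
(`exists_basis_conj_eq_self`). [cite: DeligneHodgeII1971, 2.1.4] -/
theorem GluedBlocks.exists_real_blockBasis (hconjT : ∀ i, ∀ x ∈ T i, conj x ∈ T i)
    (h2 : ∀ i, Module.finrank ℂ (T i) = 2) :
    ∃ b : ∀ i, Module.Basis (Fin 2) ℂ (T i), ∀ i a, conj (b i a : ℂ ⊗[ℚ] V) = b i a := by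
  have key : ∀ i, ∃ b : Module.Basis (Fin 2) ℂ (T i), ∀ a, conj (b a : ℂ ⊗[ℚ] V) = b a := by
    intro i
    obtain ⟨J, B, hB⟩ := exists_basis_conj_eq_self (T i) (hconjT i)
    haveI : Module.Finite ℂ (T i) := Module.finite_of_finrank_eq_succ (h2 i)
    haveI : Fintype J := FiniteDimensional.fintypeBasisIndex B
    have hcard : Fintype.card J = 2 := by rw [← Module.finrank_eq_card_basis B, h2 i]
    exact ⟨B.reindex (Fintype.equivFinOfCardEq hcard), fun a => by
      rw [Module.Basis.reindex_apply]; exact hB _⟩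
  choose b hb using key
  exact ⟨b, hb⟩

omit [Module.Finite ℚ V] [HodgeTensorFacts.{u, u}] in
/-- **Hypothesis (i): on a real block the Hodge operator has no real eigenline.** In real block bases,
`J_k = blockMat Θ k` has no eigenvector with real coordinates (it would be a non-zero REAL eigenvector of
`Θ`, impossible in odd weight: `hodgeTheta_apply_ne_smul_of_conj_eq_self`). The tree's
`blockMat_hodgeTheta_mulVec_ne_smul` for eigenblocks, verbatim for arbitrary real blocks.
[cite: Hazama1983, §3 (pp. 305–306)] [cite: Deligne1982HodgeCycles, I §3] -/
theorem GluedBlocks.blockMat_theta_mulVec_ne_smul (H : HodgeStructure V n) (hn : Odd n)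
    (hint : DirectSum.IsInternal T) (b : ∀ i, Module.Basis (Fin 2) ℂ (T i))
    (hb : ∀ i a, conj (b i a : ℂ ⊗[ℚ] V) = b i a) {Θ : Module.End ℂ (ℂ ⊗[ℚ] V)}
    (hΘ : ∀ p, ∀ x ∈ H.piece p (n - p), Θ x = ((2 * p - n : ℤ) : ℂ) • x)
    (hΘT : ∀ i, Set.MapsTo Θ (T i) (T i)) (k : ι) (v : Fin 2 → ℝ) (hv : v ≠ 0) (μ : ℂ) :
    (blockMat hint b Θ k).mulVec (fun a => algebraMap ℝ ℂ (v a)) ≠ μ • fun a => algebraMap ℝ ℂ (v a) := by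
  intro h
  obtain ⟨x, hx⟩ : ∃ x : ℂ ⊗[ℚ] V, x = ∑ a, ((v a : ℝ) : ℂ) • (b k a : ℂ ⊗[ℚ] V) := ⟨_, rfl⟩
  have hreal : conj x = x := by
    rw [hx]
    exact conj_sum_ofReal_smul v _ (hb k)
  have hx0 : x ≠ 0 := by
    intro h0
    rw [hx] at h0
    have hli : LinearIndependent ℂ fun a => (b k a : ℂ ⊗[ℚ] V) :=
      (b k).linearIndependent.map' (T k).subtype (Submodule.ker_subtype _)
    have h1 := Fintype.linearIndependent_iff.1 hli (fun a => ((v a : ℝ) : ℂ)) h0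
    apply hv
    funext a
    exact_mod_cast h1 a
  have hcoef : ∀ a, (∑ d, blockMat hint b Θ k a d * ((v d : ℝ) : ℂ)) = μ * ((v a : ℝ) : ℂ) := by
    intro a
    have h1 := congrFun h a
    simp only [Matrix.mulVec, dotProduct, Pi.smul_apply, smul_eq_mul, Complex.coe_algebraMap] at h1
    exact h1
  have hsum : ∀ (P : Fin 2 → ℂ) (Q : Fin 2 → Fin 2 → ℂ) (w : Fin 2 → ℂ ⊗[ℚ] V),
      ∑ d, P d • ∑ a, Q a d • w a = ∑ a, (∑ d, Q a d * P d) • w a := by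
    intro P Q w
    simp_rw [Finset.smul_sum, smul_smul]
    rw [Finset.sum_comm]
    refine Finset.sum_congr rfl fun a _ => ?_
    rw [Finset.sum_smul]
    exact Finset.sum_congr rfl fun d _ => by rw [mul_comm]
  have hΘx : Θ x = μ • x := by
    rw [hx, map_sum]
    simp_rw [map_smul, apply_basis_eq_sum hint b hΘT k, hsum, hcoef, ← smul_smul, ← Finset.smul_sum]
  exact hodgeTheta_apply_ne_smul_of_conj_eq_self H hn hΘ hreal hx0 μ hΘx

omit [Module.Finite ℚ V] [HodgeTensorFacts.{u, u}] [Fintype ι] [DecidableEq ι] in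
/-- **Weight one: Hodge-adapted bases of real `Θ`-stable two-dimensional blocks.** Each block has a basis
`(b_i 0, b_i 1)` with `b_i 0 ∈ V^{1,0}`, `b_i 1 ∈ V^{0,1}` (`Θ v ± v` are block vectors of pure types, one
non-zero, and its conjugate is a block vector of the opposite type; the tree's `exists_hodgeAdapted_blockBasis`
for eigenblocks, verbatim for arbitrary real `Θ`-stable blocks). Hazama 1983 §3: each `V_i` carries a Hodge
structure with `dim V_i^{1,0} = dim V_i^{0,1} = 1`. [cite: Hazama1983, §3 (pp. 305–306)]
[cite: Deligne1982HodgeCycles, §4 p. 30] -/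
theorem GluedBlocks.exists_adapted_blockBasis (H : HodgeStructure V n) (hn : n = 1) (heff : H.IsEffective)
    (hconjT : ∀ i, ∀ x ∈ T i, conj x ∈ T i) {Θ : Module.End ℂ (ℂ ⊗[ℚ] V)}
    (hΘ : ∀ p, ∀ x ∈ H.piece p (n - p), Θ x = ((2 * p - n : ℤ) : ℂ) • x)
    (hΘT : ∀ i, Set.MapsTo Θ (T i) (T i)) (h2 : ∀ i, Module.finrank ℂ (T i) = 2) :
    ∃ b : ∀ i, Module.Basis (Fin 2) ℂ (T i),
      (∀ i, (b i 0 : ℂ ⊗[ℚ] V) ∈ H.piece 1 (n - 1)) ∧ (∀ i, (b i 1 : ℂ ⊗[ℚ] V) ∈ H.piece 0 (n - 0)) := by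
  classical
  have hplusminus := fun (v : ℂ ⊗[ℚ] V) => theta_add_self_mem_piece H hn heff hΘ v
  subst hn
  have hdisj : Disjoint (H.piece 1 (1 - 1)) (H.piece 0 (1 - 0)) :=
    (iSupIndep_piece_holds H).pairwiseDisjoint (by norm_num)
  have hconj10 : ∀ {x}, x ∈ H.piece 1 (1 - 1) → conj x ∈ H.piece 0 (1 - 0) := fun {x} hx => by
    have h := conj_mem_piece H hx
    simp only [sub_self, sub_zero] at h ⊢; exact h
  have hconj01 : ∀ {x}, x ∈ H.piece 0 (1 - 0) → conj x ∈ H.piece 1 (1 - 1) := fun {x} hx => by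
    have h := conj_mem_piece H hx
    simp only [sub_self, sub_zero] at h ⊢; exact h
  have key : ∀ i, ∃ b : Module.Basis (Fin 2) ℂ (T i),
      (b 0 : ℂ ⊗[ℚ] V) ∈ H.piece 1 (1 - 1) ∧ (b 1 : ℂ ⊗[ℚ] V) ∈ H.piece 0 (1 - 0) := by
    intro i
    haveI : Module.Finite ℂ (T i) := Module.finite_of_finrank_eq_succ (h2 i)
    obtain ⟨x₀, x₁, hx₀T, hx₁T, hx₀, hx₁, hx₀0, hx₁0⟩ : ∃ x₀ x₁ : ℂ ⊗[ℚ] V, x₀ ∈ T i ∧ x₁ ∈ T i ∧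
        x₀ ∈ H.piece 1 (1 - 1) ∧ x₁ ∈ H.piece 0 (1 - 0) ∧ x₀ ≠ 0 ∧ x₁ ≠ 0 := by
      obtain ⟨v, hvT, hv0⟩ : ∃ v : ℂ ⊗[ℚ] V, v ∈ T i ∧ v ≠ 0 := by
        set b' := Module.finBasisOfFinrankEq ℂ (T i) (h2 i)
        exact ⟨b' 0, (b' 0).2, fun h => b'.ne_zero 0 (Subtype.ext h)⟩
      have hΘv : Θ v ∈ T i := hΘT i hvT
      obtain ⟨hplus, hminus⟩ := hplusminus v
      by_cases hp : Θ v + v = 0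
      · have hm : Θ v - v ≠ 0 := by
          intro hm
          apply hv0
          have h2v : (Θ v + v) - (Θ v - v) = 0 := by rw [hp, hm, sub_zero]
          have : (2 : ℂ) • v = 0 := by rw [two_smul]; convert h2v using 1; abel
          exact (smul_eq_zero.1 this).resolve_left two_ne_zero
        refine ⟨conj (Θ v - v), Θ v - v, hconjT i _ (Submodule.sub_mem _ hΘv hvT),
          Submodule.sub_mem _ hΘv hvT, hconj01 hminus, hminus, ?_, hm⟩
        intro h
        exact hm (by rw [← conj_conj (Θ v - v), h, map_zero])
      · refine ⟨Θ v + v, conj (Θ v + v), Submodule.add_mem _ hΘv hvT,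
          hconjT i _ (Submodule.add_mem _ hΘv hvT), hplus, hconj10 hplus, hp, ?_⟩
        intro h
        exact hp (by rw [← conj_conj (Θ v + v), h, map_zero])
    have hli : LinearIndependent ℂ ![(⟨x₀, hx₀T⟩ : T i), ⟨x₁, hx₁T⟩] := by
      rw [LinearIndependent.pair_iff]
      intro s t hst
      have hst' : s • x₀ + t • x₁ = 0 := by
        have := congrArg Subtype.val hst
        simpa using this
      have hsx : s • x₀ ∈ H.piece 1 (1 - 1) ⊓ H.piece 0 (1 - 0) := by
        refine ⟨Submodule.smul_mem _ _ hx₀, ?_⟩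
        have : s • x₀ = -(t • x₁) := eq_neg_of_add_eq_zero_left hst'
        rw [this]
        exact Submodule.neg_mem _ (Submodule.smul_mem _ _ hx₁)
      rw [hdisj.eq_bot, Submodule.mem_bot] at hsx
      have hs : s = 0 := (smul_eq_zero.1 hsx).resolve_right hx₀0
      rw [hs, zero_smul, zero_add] at hst'
      exact ⟨hs, (smul_eq_zero.1 hst').resolve_right hx₁0⟩
    refine ⟨basisOfLinearIndependentOfCardEqFinrank hli (by rw [Fintype.card_fin, h2 i]), ?_, ?_⟩
    · rw [coe_basisOfLinearIndependentOfCardEqFinrank]; exact hx₀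
    · rw [coe_basisOfLinearIndependentOfCardEqFinrank]; exact hx₁
  choose b hb0 hb1 using key
  exact ⟨b, hb0, hb1⟩

omit [Module.Finite ℚ V] [HodgeTensorFacts.{u, u}] [Fintype ι] [DecidableEq ι] in
/-- Elements of `E ⊗ ℂ = span_ℂ {a_ℂ : a ∈ End_Hdg(V)}` preserve every Hodge piece `V^{p,q}`
(`endAlg.baseChange_mem_piece`, extended by linearity). [cite: Zarhin1983HodgeGroupsK3, §2] -/
theorem GluedBlocks.apply_mem_piece_of_mem_span_endAlg (H : HodgeStructure V n)
    {u : Module.End ℂ (ℂ ⊗[ℚ] V)}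
    (hu : u ∈ Submodule.span ℂ ((fun a : Module.End ℚ V => a.baseChange ℂ) '' (H.endAlg : Set _)))
    {p q : ℤ} {x : ℂ ⊗[ℚ] V} (hx : x ∈ H.piece p q) : u x ∈ H.piece p q := by
  induction hu using Submodule.span_induction with
  | mem Z hZ =>
    obtain ⟨a, ha, rfl⟩ := hZ
    exact endAlg.baseChange_mem_piece ⟨a, ha⟩ hx
  | zero => rw [LinearMap.zero_apply]; exact Submodule.zero_mem _
  | add Z Z' _ _ hZ hZ' => rw [LinearMap.add_apply]; exact Submodule.add_mem _ hZ hZ'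
  | smul c Z _ hZ => rw [LinearMap.smul_apply]; exact Submodule.smul_mem _ c hZ

omit [Module.Finite ℚ V] [HodgeTensorFacts.{u, u}] [Fintype ι] [DecidableEq ι] in
/-- The complexification of a rational operator commuting with `End_Hdg(V)` commutes with `E ⊗ ℂ`.
[cite: Zarhin1983HodgeGroupsK3, §2] -/
theorem GluedBlocks.baseChange_comm_of_mem_span_endAlg (H : HodgeStructure V n) {X : Module.End ℚ V}
    (hcomm : ∀ a : H.endAlg, X * (a : Module.End ℚ V) = (a : Module.End ℚ V) * X)
    {u : Module.End ℂ (ℂ ⊗[ℚ] V)}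
    (hu : u ∈ Submodule.span ℂ ((fun a : Module.End ℚ V => a.baseChange ℂ) '' (H.endAlg : Set _))) :
    X.baseChange ℂ * u = u * X.baseChange ℂ := by
  induction hu using Submodule.span_induction with
  | mem Z hZ =>
    obtain ⟨a, ha, rfl⟩ := hZ
    rw [← LinearMap.baseChange_mul, hcomm ⟨a, ha⟩, LinearMap.baseChange_mul]
  | zero => rw [mul_zero, zero_mul]
  | add Z Z' _ _ hZ hZ' => rw [mul_add, add_mul, hZ, hZ']
  | smul c Z _ hZ => rw [mul_smul_comm, smul_mul_assoc, hZ]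

end RealAdapted

/-! ### §3 One admissible algebra in REAL block bases: trace-free blocks (perfectness), hypotheses (i), (a), Goursat with classes -/

section Admissible

universe u

variable {V : Type u} [AddCommGroup V] [Module ℚ V] [Module.Finite ℚ V] [HodgeTensorFacts.{u, u}] {n : ℤ}
variable {ι : Type*} [Fintype ι] [DecidableEq ι] {T : ι → Submodule ℂ (ℂ ⊗[ℚ] V)}

/-- **Blocks of an admissible algebra are trace-free, by PERFECTNESS** (no orthogonality of the blocks is
used): `𝔤 = [𝔤, 𝔤]` when `E` has no `ψ`-skew central element (the tree's
`eq_span_commutators_of_forall_central_skew_eq_zero`, Deligne I 3.6 / Moonen–Zarhin §1 in Lie form), and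
blocks of commutators of block-preserving operators have trace zero. [cite: MoonenZarhin1999LowDim, §1]
[cite: Deligne1982HodgeCycles, I §3 Prop. 3.6] [cite: Hazama1983, §3 (p. 305)] -/
theorem GluedBlocks.trace_blockMat_baseChange_eq_zero (H : HodgeStructure V n) (hn : n = 1)
    (heff : H.IsEffective) (ψ : H.Polarization) (hint : DirectSum.IsInternal T)
    (b : ∀ i, Module.Basis (Fin 2) ℂ (T i)) (𝔤 : Submodule ℚ (Module.End ℚ V))
    (hbr : ∀ X ∈ 𝔤, ∀ Y ∈ 𝔤, X * Y - Y * X ∈ 𝔤)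
    {Θ : Module.End ℂ (ℂ ⊗[ℚ] V)} (hΘ : ∀ p, ∀ x ∈ H.piece p (n - p), Θ x = ((2 * p - n : ℤ) : ℂ) • x)
    (hΘ𝔤 : Θ ∈ spanC 𝔤)
    (hcomm : ∀ X ∈ 𝔤, ∀ a : H.endAlg, X * (a : Module.End ℚ V) = (a : Module.End ℚ V) * X)
    (hskew : ∀ X ∈ 𝔤, ∀ v w, ψ.form (X v) w + ψ.form v (X w) = 0)
    (hT : ∀ X ∈ 𝔤, ∀ i, Set.MapsTo (X.baseChange ℂ) (T i) (T i))
    (hE : ∀ a ∈ H.endAlg, (∀ b ∈ H.endAlg, a * b = b * a) →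
      (∀ v w, ψ.form (a v) w + ψ.form v (a w) = 0) → a = 0)
    {X : Module.End ℚ V} (hX : X ∈ 𝔤) (k : ι) : (blockMat hint b (X.baseChange ℂ) k).trace = 0 := by
  have h𝔤 := eq_span_commutators_of_forall_central_skew_eq_zero H hn heff ψ 𝔤 hbr hΘ hΘ𝔤 hcomm hskew hE
  rw [h𝔤] at hX
  induction hX using Submodule.span_induction with
  | mem B hB =>
    obtain ⟨X₁, hX₁, X₂, hX₂, rfl⟩ := hB
    rw [LinearMap.baseChange_sub, LinearMap.baseChange_mul, LinearMap.baseChange_mul]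
    exact GluedBlocks.trace_blockMat_commutator hint b (hT X₁ hX₁) (hT X₂ hX₂) k
  | zero => rw [LinearMap.baseChange_zero, map_zero, Pi.zero_apply, Matrix.trace_zero]
  | add X₁ X₂ _ _ h₁ h₂ =>
    rw [LinearMap.baseChange_add, map_add, Pi.add_apply, Matrix.trace_add, h₁, h₂, add_zero]
  | smul c X₁ _ h₁ =>
    rw [LinearMap.baseChange_smul, ← algebraMap_smul ℂ c (X₁.baseChange ℂ), map_smul, Pi.smul_apply,
      Matrix.trace_smul, h₁, smul_zero]

/-- Trace-freeness of the blocks of every element of `𝔤_ℂ`. [cite: Hazama1983, §3 (p. 305)]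
[cite: MoonenZarhin1999LowDim, §1] -/
theorem GluedBlocks.trace_blockMat_eq_zero_of_mem_spanC (H : HodgeStructure V n) (hn : n = 1)
    (heff : H.IsEffective) (ψ : H.Polarization) (hint : DirectSum.IsInternal T)
    (b : ∀ i, Module.Basis (Fin 2) ℂ (T i)) (𝔤 : Submodule ℚ (Module.End ℚ V))
    (hbr : ∀ X ∈ 𝔤, ∀ Y ∈ 𝔤, X * Y - Y * X ∈ 𝔤)
    {Θ : Module.End ℂ (ℂ ⊗[ℚ] V)} (hΘ : ∀ p, ∀ x ∈ H.piece p (n - p), Θ x = ((2 * p - n : ℤ) : ℂ) • x)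
    (hΘ𝔤 : Θ ∈ spanC 𝔤)
    (hcomm : ∀ X ∈ 𝔤, ∀ a : H.endAlg, X * (a : Module.End ℚ V) = (a : Module.End ℚ V) * X)
    (hskew : ∀ X ∈ 𝔤, ∀ v w, ψ.form (X v) w + ψ.form v (X w) = 0)
    (hT : ∀ X ∈ 𝔤, ∀ i, Set.MapsTo (X.baseChange ℂ) (T i) (T i))
    (hE : ∀ a ∈ H.endAlg, (∀ b ∈ H.endAlg, a * b = b * a) →
      (∀ v w, ψ.form (a v) w + ψ.form v (a w) = 0) → a = 0)
    {Y : Module.End ℂ (ℂ ⊗[ℚ] V)} (hY : Y ∈ spanC 𝔤) (k : ι) : (blockMat hint b Y k).trace = 0 := by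
  induction hY using Submodule.span_induction with
  | mem Z hZ =>
    obtain ⟨X, hX, rfl⟩ := hZ
    exact GluedBlocks.trace_blockMat_baseChange_eq_zero H hn heff ψ hint b 𝔤 hbr hΘ hΘ𝔤 hcomm hskew hT hE hX k
  | zero => rw [map_zero, Pi.zero_apply, Matrix.trace_zero]
  | add Z Z' _ _ hZ hZ' => rw [map_add, Pi.add_apply, Matrix.trace_add, hZ, hZ', add_zero]
  | smul c Z _ hZ => rw [map_smul, Pi.smul_apply, Matrix.trace_smul, hZ, smul_zero]

omit [Module.Finite ℚ V] [HodgeTensorFacts.{u, u}] [Fintype ι] [DecidableEq ι] in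
/-- Products of block-preserving operators preserve the blocks. [folklore] -/
private theorem GluedBlocks.mapsTo_mul {f g : Module.End ℂ (ℂ ⊗[ℚ] V)} (hf : ∀ i, Set.MapsTo f (T i) (T i))
    (hg : ∀ i, Set.MapsTo g (T i) (T i)) (i : ι) : Set.MapsTo (f * g) (T i) (T i) :=
  fun _ hx => hf i (hg i hx)

omit [HodgeTensorFacts.{u, u}] in
/-- **Hypothesis (a): at every block two elements of `𝔤` have non-commuting blocks.** Otherwise the
`k`-blocks of `𝔤_ℂ` commute with `J_k = blockMat Θ k` (`Θ ∈ 𝔤_ℂ`); the operator `P = Θ|_{T_k} ⊕ 0` then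
commutes with `𝔤`, so lies in `E ⊗ ℂ` (`ThetaSubalgebra.mem_span_endAlg_of_forall_commute`), preserves
every block, hence is a SCALAR on `T_k` by `hscal` — and `Θ` would have a non-zero real eigenvector.
Hazama 1983 §3: «`p_i(𝔥) = 𝔰𝔩₂`». [cite: Hazama1983, §3 (pp. 305–306)] [cite: Zarhin1983HodgeGroupsK3, §2] -/
theorem GluedBlocks.exists_realBlocks_commutator_ne_zero (H : HodgeStructure V n) (hn : Odd n)
    (hint : DirectSum.IsInternal T) (b : ∀ i, Module.Basis (Fin 2) ℂ (T i))
    (hb : ∀ i a, conj (b i a : ℂ ⊗[ℚ] V) = b i a)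
    (hscal : ∀ u ∈ Submodule.span ℂ ((fun a : Module.End ℚ V => a.baseChange ℂ) '' (H.endAlg : Set _)),
      (∀ i, Set.MapsTo u (T i) (T i)) → ∀ i, ∃ c : ℂ, ∀ x ∈ T i, u x = c • x)
    (𝔤 : Submodule ℚ (Module.End ℚ V))
    {Θ : Module.End ℂ (ℂ ⊗[ℚ] V)} (hΘ : ∀ p, ∀ x ∈ H.piece p (n - p), Θ x = ((2 * p - n : ℤ) : ℂ) • x)
    (hΘ𝔤 : Θ ∈ spanC 𝔤) (hT : ∀ X ∈ 𝔤, ∀ i, Set.MapsTo (X.baseChange ℂ) (T i) (T i)) (k : ι) :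
    ∃ A ∈ realBlocks hint b '' (𝔤 : Set (Module.End ℚ V)),
      ∃ B ∈ realBlocks hint b '' (𝔤 : Set (Module.End ℚ V)), A k * B k - B k * A k ≠ 0 := by
  by_contra hcon
  push Not at hcon
  have hcomm : ∀ X ∈ 𝔤, ∀ Y ∈ 𝔤,
      blockMat hint b (X.baseChange ℂ) k * blockMat hint b (Y.baseChange ℂ) k =
        blockMat hint b (Y.baseChange ℂ) k * blockMat hint b (X.baseChange ℂ) k := by
    intro X hX Y hY
    have h := congrArg (algebraMap ℝ ℂ).mapMatrix (hcon _ ⟨X, hX, rfl⟩ _ ⟨Y, hY, rfl⟩)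
    rw [map_sub, map_mul, map_mul, map_zero, RingHom.mapMatrix_apply, RingHom.mapMatrix_apply,
      realBlocks_map_apply hint b hb, realBlocks_map_apply hint b hb] at h
    exact sub_eq_zero.1 h
  have hΘT : ∀ i, Set.MapsTo Θ (T i) (T i) := fun i =>
    mapsTo_of_mem_spanC (T := T i) (fun X hX => hT X hX i) hΘ𝔤
  have hJ : ∀ X ∈ 𝔤, blockMat hint b Θ k * blockMat hint b (X.baseChange ℂ) k =
      blockMat hint b (X.baseChange ℂ) k * blockMat hint b Θ k := by
    intro X hX
    have key : ∀ Y ∈ spanC 𝔤, blockMat hint b Y k * blockMat hint b (X.baseChange ℂ) k =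
        blockMat hint b (X.baseChange ℂ) k * blockMat hint b Y k := by
      intro Y hY
      induction hY using Submodule.span_induction with
      | mem Z hZ =>
        obtain ⟨X', hX', rfl⟩ := hZ
        exact hcomm X' hX' X hX
      | zero => rw [map_zero, Pi.zero_apply, zero_mul, mul_zero]
      | add Z Z' _ _ hZ hZ' => rw [map_add, Pi.add_apply, add_mul, mul_add, hZ, hZ']
      | smul c Z _ hZ => rw [map_smul, Pi.smul_apply, smul_mul_assoc, mul_smul_comm, hZ]
    exact key Θ hΘ𝔤
  set P := assemble hint b (Pi.single k (blockMat hint b Θ k)) with hPdef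
  have hPT : ∀ i, Set.MapsTo P (T i) (T i) := assemble_mapsTo hint b _
  have hPblk : blockMat hint b P = Pi.single k (blockMat hint b Θ k) := blockMat_assemble hint b _
  have hPcomm : ∀ X ∈ 𝔤, P * X.baseChange ℂ = X.baseChange ℂ * P := by
    intro X hX
    have hXT := hT X hX
    refine eq_of_blockMat_eq hint b (GluedBlocks.mapsTo_mul hPT hXT) (GluedBlocks.mapsTo_mul hXT hPT) ?_
    rw [blockMat_mul hint b hPT hXT, blockMat_mul hint b hXT hPT, hPblk]
    funext k'
    rw [Pi.mul_apply, Pi.mul_apply]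
    by_cases hk : k' = k
    · rw [hk, Pi.single_eq_same]
      exact hJ X hX
    · rw [Pi.single_eq_of_ne hk, zero_mul, mul_zero]
  obtain ⟨c, hc⟩ := hscal P (ThetaSubalgebra.mem_span_endAlg_of_forall_commute H 𝔤 hΘ hΘ𝔤 hPcomm) hPT k
  have hPΘ : P (b k 0) = Θ (b k 0) := by
    rw [assemble_apply_basis, apply_basis_eq_sum hint b hΘT k 0]
    simp only [Pi.single_eq_same]
  have hne : (b k 0 : ℂ ⊗[ℚ] V) ≠ 0 := fun h => (b k).ne_zero 0 ((Submodule.coe_eq_zero).1 h)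
  exact hodgeTheta_apply_ne_smul_of_conj_eq_self H hn hΘ (hb k 0) hne c
    (by rw [← hPΘ]; exact hc _ (b k 0).2)

/-- **Goursat with classes for an admissible algebra, in real block bases.** For every block `i` and every
real trace-free `Z` there is a real combination `z` of the real blocks of elements of `𝔤` with `z i = Z` and
`z k = 0` at every `k ≠ i` not conjugate to `i` (`IsBlockConj`). The places form
`exists_mem_span_apply_eq_of_places` (`F = ℝ`, `K = ℂ`) fed with bracket-closedness, trace-freeness
(perfectness), `J = blockMat Θ` (`Θ ∈ 𝔤_ℂ`) without real eigenlines, and (a). Hazama 1983 §3: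
«`𝔥 = 𝔰𝔩₂ × ⋯ × 𝔰𝔩₂` (k-times) where the i-th component acts on `V_i ⊕ ⋯ ⊕ V_i` diagonally».
[cite: Hazama1983, §3 (pp. 305–306), Prop. (2.6) and Lemma (3.1)] [cite: MoonenZarhin1999LowDim, §3 (3.1)] -/
theorem GluedBlocks.exists_mem_span_realBlocks (H : HodgeStructure V n) (hn : n = 1)
    (heff : H.IsEffective) (ψ : H.Polarization) (hint : DirectSum.IsInternal T)
    (b : ∀ i, Module.Basis (Fin 2) ℂ (T i)) (hb : ∀ i a, conj (b i a : ℂ ⊗[ℚ] V) = b i a)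
    (hscal : ∀ u ∈ Submodule.span ℂ ((fun a : Module.End ℚ V => a.baseChange ℂ) '' (H.endAlg : Set _)),
      (∀ i, Set.MapsTo u (T i) (T i)) → ∀ i, ∃ c : ℂ, ∀ x ∈ T i, u x = c • x)
    (𝔤 : Submodule ℚ (Module.End ℚ V)) (hbr : ∀ X ∈ 𝔤, ∀ Y ∈ 𝔤, X * Y - Y * X ∈ 𝔤)
    {Θ : Module.End ℂ (ℂ ⊗[ℚ] V)} (hΘ : ∀ p, ∀ x ∈ H.piece p (n - p), Θ x = ((2 * p - n : ℤ) : ℂ) • x)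
    (hΘ𝔤 : Θ ∈ spanC 𝔤)
    (hcomm : ∀ X ∈ 𝔤, ∀ a : H.endAlg, X * (a : Module.End ℚ V) = (a : Module.End ℚ V) * X)
    (hskew : ∀ X ∈ 𝔤, ∀ v w, ψ.form (X v) w + ψ.form v (X w) = 0)
    (hT : ∀ X ∈ 𝔤, ∀ i, Set.MapsTo (X.baseChange ℂ) (T i) (T i))
    (hE : ∀ a ∈ H.endAlg, (∀ b ∈ H.endAlg, a * b = b * a) →
      (∀ v w, ψ.form (a v) w + ψ.form v (a w) = 0) → a = 0)
    (i : ι) (Z : Matrix (Fin 2) (Fin 2) ℝ) (hZ : Z.trace = 0) :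
    ∃ z ∈ Submodule.span ℝ (realBlocks hint b '' (𝔤 : Set (Module.End ℚ V))), z i = Z ∧
      ∀ k, k ≠ i → ¬ IsBlockConj (realBlocks hint b '' (𝔤 : Set (Module.End ℚ V))) i k → z k = 0 := by
  classical
  have hodd : Odd n := by rw [hn]; exact odd_one
  have hΘT : ∀ j, Set.MapsTo Θ (T j) (T j) := fun j =>
    mapsTo_of_mem_spanC (T := T j) (fun X hX => hT X hX j) hΘ𝔤
  refine exists_mem_span_apply_eq_of_places (F := ℝ) (K := ℂ)
    (realBlocks hint b '' (𝔤 : Set (Module.End ℚ V))) ?_ ?_ (J := blockMat hint b Θ) ?_ ?_ ?_ i Z hZ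
  · -- bracket-closed: the real blocks of `XY - YX`
    rintro _ ⟨X, hX, rfl⟩ _ ⟨Y, hY, rfl⟩
    refine Submodule.subset_span ⟨X * Y - Y * X, hbr X hX Y hY, ?_⟩
    have hXT := hT X hX
    have hYT := hT Y hY
    funext k
    apply Matrix.map_injective (algebraMap ℝ ℂ).injective
    change (realBlocks hint b (X * Y - Y * X) k).map (algebraMap ℝ ℂ) =
      ((realBlocks hint b X * realBlocks hint b Y - realBlocks hint b Y * realBlocks hint b X) k).map
        (algebraMap ℝ ℂ)
    rw [realBlocks_map_apply hint b hb, Pi.sub_apply, Pi.mul_apply, Pi.mul_apply,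
      ← RingHom.mapMatrix_apply, map_sub, map_mul, map_mul, RingHom.mapMatrix_apply,
      RingHom.mapMatrix_apply, realBlocks_map_apply hint b hb, realBlocks_map_apply hint b hb,
      LinearMap.baseChange_sub, LinearMap.baseChange_mul, LinearMap.baseChange_mul, map_sub,
      blockMat_mul hint b hXT hYT, blockMat_mul hint b hYT hXT]
    rfl
  · -- slotwise trace-free (perfectness)
    rintro _ ⟨X, hX, rfl⟩ k
    have h0 := GluedBlocks.trace_blockMat_baseChange_eq_zero H hn heff ψ hint b 𝔤 hbr hΘ hΘ𝔤 hcomm hskew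
      hT hE hX k
    rw [Matrix.trace_fin_two] at h0 ⊢
    change (blockMat hint b (X.baseChange ℂ) k).map Complex.re 0 0 +
      (blockMat hint b (X.baseChange ℂ) k).map Complex.re 1 1 = 0
    rw [Matrix.map_apply, Matrix.map_apply, ← Complex.add_re, h0, Complex.zero_re]
  · -- `J` lies in the complex span of the images
    have hset : (fun A : ι → Matrix (Fin 2) (Fin 2) ℝ => fun k => (A k).map (algebraMap ℝ ℂ)) ''
        (realBlocks hint b '' (𝔤 : Set (Module.End ℚ V))) =
        (fun X : Module.End ℚ V => blockMat hint b (X.baseChange ℂ)) '' (𝔤 : Set (Module.End ℚ V)) := by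
      rw [Set.image_image]
      exact Set.image_congr fun X _ => realBlocks_map hint b hb X
    rw [hset]
    have key : ∀ Y ∈ spanC 𝔤, blockMat hint b Y ∈ Submodule.span ℂ
        ((fun X : Module.End ℚ V => blockMat hint b (X.baseChange ℂ)) '' (𝔤 : Set (Module.End ℚ V))) := by
      intro Y hY
      induction hY using Submodule.span_induction with
      | mem Z hZ =>
        obtain ⟨X, hX, rfl⟩ := hZ
        exact Submodule.subset_span ⟨X, hX, rfl⟩
      | zero => rw [map_zero]; exact Submodule.zero_mem _
      | add Z Z' _ _ hZ hZ' => rw [map_add]; exact Submodule.add_mem _ hZ hZ'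
      | smul c Z _ hZ => rw [map_smul]; exact Submodule.smul_mem _ c hZ
    exact key Θ hΘ𝔤
  · exact fun k v hv μ => GluedBlocks.blockMat_theta_mulVec_ne_smul H hodd hint b hb hΘ hΘT k v hv μ
  · exact fun k => GluedBlocks.exists_realBlocks_commutator_ne_zero H hodd hint b hb hscal 𝔤 hΘ hΘ𝔤 hT k

omit [Module.Finite ℚ V] [HodgeTensorFacts.{u, u}] in
/-- **Complexification of real combinations of real blocks**: for `A` in the real span of the real blocks of
elements of `𝔤`, the block-diagonal operator with blocks `A ⊗ ℂ` lies in `𝔤_ℂ`. [cite: Hazama1983, §3 (pp. 305–306)] -/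
theorem GluedBlocks.assemble_ofReal_mem_spanC (hint : DirectSum.IsInternal T)
    (b : ∀ i, Module.Basis (Fin 2) ℂ (T i)) (hb : ∀ i a, conj (b i a : ℂ ⊗[ℚ] V) = b i a)
    (𝔤 : Submodule ℚ (Module.End ℚ V)) (hT : ∀ X ∈ 𝔤, ∀ i, Set.MapsTo (X.baseChange ℂ) (T i) (T i))
    {A : ι → Matrix (Fin 2) (Fin 2) ℝ}
    (hA : A ∈ Submodule.span ℝ (realBlocks hint b '' (𝔤 : Set (Module.End ℚ V)))) :
    assemble hint b (fun k => (A k).map (algebraMap ℝ ℂ)) ∈ spanC 𝔤 := by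
  have hΦ : ∀ A ∈ Submodule.span ℝ (realBlocks hint b '' (𝔤 : Set (Module.End ℚ V))),
      (fun k => (A k).map (algebraMap ℝ ℂ)) ∈ Submodule.span ℂ
        ((fun X : Module.End ℚ V => blockMat hint b (X.baseChange ℂ)) '' (𝔤 : Set (Module.End ℚ V))) := by
    intro A hA
    induction hA using Submodule.span_induction with
    | mem A hA =>
      obtain ⟨X, hX, rfl⟩ := hA
      rw [realBlocks_map hint b hb X]
      exact Submodule.subset_span ⟨X, hX, rfl⟩
    | zero =>
      have h0 : (fun k => ((0 : ι → Matrix (Fin 2) (Fin 2) ℝ) k).map (algebraMap ℝ ℂ)) = 0 := by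
        funext k
        rw [Pi.zero_apply, Pi.zero_apply, ← RingHom.mapMatrix_apply, map_zero]
      rw [h0]
      exact Submodule.zero_mem _
    | add A A' _ _ hA hA' =>
      have hadd : (fun k => ((A + A') k).map (algebraMap ℝ ℂ)) =
          (fun k => (A k).map (algebraMap ℝ ℂ)) + fun k => (A' k).map (algebraMap ℝ ℂ) := by
        funext k
        rw [Pi.add_apply, Pi.add_apply, ← RingHom.mapMatrix_apply, map_add, RingHom.mapMatrix_apply,
          RingHom.mapMatrix_apply]
      rw [hadd]
      exact Submodule.add_mem _ hA hA'
    | smul r A _ hA =>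
      have hsmul : (fun k => ((r • A) k).map (algebraMap ℝ ℂ)) =
          (r : ℂ) • fun k => (A k).map (algebraMap ℝ ℂ) := by
        funext k
        refine Matrix.ext fun a c => ?_
        simp only [Pi.smul_apply, Matrix.map_apply, Matrix.smul_apply, smul_eq_mul,
          Complex.coe_algebraMap, Complex.ofReal_mul]
      rw [hsmul]
      exact Submodule.smul_mem _ (r : ℂ) hA
  have key : ∀ M ∈ Submodule.span ℂ
      ((fun X : Module.End ℚ V => blockMat hint b (X.baseChange ℂ)) '' (𝔤 : Set (Module.End ℚ V))),
      assemble hint b M ∈ spanC 𝔤 := by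
    intro M hM
    induction hM using Submodule.span_induction with
    | mem M hM =>
      obtain ⟨X, hX, rfl⟩ := hM
      rw [assemble_blockMat hint b (hT X hX)]
      exact baseChange_mem_spanC hX
    | zero => rw [map_zero]; exact Submodule.zero_mem _
    | add M M' _ _ hM hM' => rw [map_add]; exact Submodule.add_mem _ hM hM'
    | smul c M _ hM => rw [map_smul]; exact Submodule.smul_mem _ c hM
  exact key _ (hΦ A hA)

/-- **`𝔤_ℂ` reaches every block modulo its conjugates** (complex form): for every block `i` and every
trace-free complex `N` there is `Y ∈ 𝔤_ℂ`, block-preserving, with `i`-block `N` and zero blocks at every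
`k ≠ i` not conjugate to `i` for the real blocks of `𝔤`. [cite: Hazama1983, §3 (pp. 305–306), Prop. (2.6) and Lemma (3.1)]
[cite: MoonenZarhin1999LowDim, (2.2) and §3 (3.1)] -/
theorem GluedBlocks.exists_mem_spanC_blockMat_eq (H : HodgeStructure V n) (hn : n = 1)
    (heff : H.IsEffective) (ψ : H.Polarization) (hint : DirectSum.IsInternal T)
    (b : ∀ i, Module.Basis (Fin 2) ℂ (T i)) (hb : ∀ i a, conj (b i a : ℂ ⊗[ℚ] V) = b i a)
    (hscal : ∀ u ∈ Submodule.span ℂ ((fun a : Module.End ℚ V => a.baseChange ℂ) '' (H.endAlg : Set _)),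
      (∀ i, Set.MapsTo u (T i) (T i)) → ∀ i, ∃ c : ℂ, ∀ x ∈ T i, u x = c • x)
    (𝔤 : Submodule ℚ (Module.End ℚ V)) (hbr : ∀ X ∈ 𝔤, ∀ Y ∈ 𝔤, X * Y - Y * X ∈ 𝔤)
    {Θ : Module.End ℂ (ℂ ⊗[ℚ] V)} (hΘ : ∀ p, ∀ x ∈ H.piece p (n - p), Θ x = ((2 * p - n : ℤ) : ℂ) • x)
    (hΘ𝔤 : Θ ∈ spanC 𝔤)
    (hcomm : ∀ X ∈ 𝔤, ∀ a : H.endAlg, X * (a : Module.End ℚ V) = (a : Module.End ℚ V) * X)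
    (hskew : ∀ X ∈ 𝔤, ∀ v w, ψ.form (X v) w + ψ.form v (X w) = 0)
    (hT : ∀ X ∈ 𝔤, ∀ i, Set.MapsTo (X.baseChange ℂ) (T i) (T i))
    (hE : ∀ a ∈ H.endAlg, (∀ b ∈ H.endAlg, a * b = b * a) →
      (∀ v w, ψ.form (a v) w + ψ.form v (a w) = 0) → a = 0)
    (i : ι) (N : Matrix (Fin 2) (Fin 2) ℂ) (hN : N.trace = 0) :
    ∃ Y ∈ spanC 𝔤, (∀ j, Set.MapsTo Y (T j) (T j)) ∧ blockMat hint b Y i = N ∧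
      ∀ k, k ≠ i → ¬ IsBlockConj (realBlocks hint b '' (𝔤 : Set (Module.End ℚ V))) i k →
        blockMat hint b Y k = 0 := by
  classical
  -- real and imaginary parts
  set Nre : Matrix (Fin 2) (Fin 2) ℝ := N.map Complex.re with hNre
  set Nim : Matrix (Fin 2) (Fin 2) ℝ := N.map Complex.im with hNim
  have htr_re : Nre.trace = 0 := by
    rw [Matrix.trace_fin_two] at hN ⊢
    simp only [hNre, Matrix.map_apply]
    rw [← Complex.add_re, hN, Complex.zero_re]
  have htr_im : Nim.trace = 0 := by
    rw [Matrix.trace_fin_two] at hN ⊢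
    simp only [hNim, Matrix.map_apply]
    rw [← Complex.add_im, hN, Complex.zero_im]
  obtain ⟨zr, hzr, hzri, hzrk⟩ := GluedBlocks.exists_mem_span_realBlocks H hn heff ψ hint b hb hscal 𝔤 hbr hΘ
    hΘ𝔤 hcomm hskew hT hE i Nre htr_re
  obtain ⟨zi, hzi, hzii, hzik⟩ := GluedBlocks.exists_mem_span_realBlocks H hn heff ψ hint b hb hscal 𝔤 hbr hΘ
    hΘ𝔤 hcomm hskew hT hE i Nim htr_im
  set cplx : (ι → Matrix (Fin 2) (Fin 2) ℝ) → (ι → Matrix (Fin 2) (Fin 2) ℂ) :=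
    fun A => fun k => (A k).map (algebraMap ℝ ℂ) with hcplx
  refine ⟨assemble hint b (cplx zr) + Complex.I • assemble hint b (cplx zi), ?_, ?_, ?_, ?_⟩
  · exact Submodule.add_mem _ (GluedBlocks.assemble_ofReal_mem_spanC hint b hb 𝔤 hT hzr)
      (Submodule.smul_mem _ _ (GluedBlocks.assemble_ofReal_mem_spanC hint b hb 𝔤 hT hzi))
  · intro j x hx
    rw [LinearMap.add_apply, LinearMap.smul_apply]
    exact Submodule.add_mem _ (assemble_mapsTo hint b _ j hx)
      (Submodule.smul_mem _ _ (assemble_mapsTo hint b _ j hx))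
  · rw [map_add, map_smul, blockMat_assemble, blockMat_assemble, Pi.add_apply, Pi.smul_apply]
    simp only [hcplx, hzri, hzii]
    ext a c
    simp only [hNre, hNim, Matrix.add_apply, Matrix.smul_apply, Matrix.map_apply, Complex.coe_algebraMap,
      smul_eq_mul]
    rw [mul_comm, Complex.re_add_im]
  · intro k hki hnc
    rw [map_add, map_smul, blockMat_assemble, blockMat_assemble, Pi.add_apply, Pi.smul_apply]
    simp only [hcplx, hzrk k hki hnc, hzik k hki hnc]
    rw [← RingHom.mapMatrix_apply, map_zero, smul_zero, add_zero]

end Admissible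

/-! ### §4 Conjugacy classes of blocks are the same for all admissible algebras; glued Hodge-adapted bases; the theorem -/

section Glued

universe u

variable {V : Type u} [AddCommGroup V] [Module ℚ V] [Module.Finite ℚ V] [HodgeTensorFacts.{u, u}] {n : ℤ}
variable {ι : Type*} [Fintype ι] [DecidableEq ι] {T : ι → Submodule ℂ (ℂ ⊗[ℚ] V)}

omit [HodgeTensorFacts.{u, u}] in
/-- **Conjugacy of blocks does not depend on the admissible algebra.** If the real blocks of `𝔤₁` at `i`
are conjugate to those at `k` (`IsBlockConj`), and `Θ ∈ (𝔤₁)_ℂ`, then the conjugating intertwiner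
`T_k → T_i` commutes with `𝔤₁`, hence lies in `E ⊗ ℂ` (`ThetaSubalgebra.mem_span_endAlg_of_forall_commute`),
hence commutes with every `𝔤₂` commuting with `E` — so the real blocks of `𝔤₂` are conjugate through the
same matrix (Hazama 1983 Lemma (3.1): isomorphic `𝔥`-modules ⟺ graph position). [cite: Hazama1983, Lemma (3.1) and §3 (p. 306)]
[cite: Zarhin1983HodgeGroupsK3, §2] -/
theorem GluedBlocks.isBlockConj_of_isBlockConj (H : HodgeStructure V n) (hint : DirectSum.IsInternal T)
    (b : ∀ i, Module.Basis (Fin 2) ℂ (T i)) (hb : ∀ i a, conj (b i a : ℂ ⊗[ℚ] V) = b i a)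
    (𝔤₁ 𝔤₂ : Submodule ℚ (Module.End ℚ V))
    {Θ : Module.End ℂ (ℂ ⊗[ℚ] V)} (hΘ : ∀ p, ∀ x ∈ H.piece p (n - p), Θ x = ((2 * p - n : ℤ) : ℂ) • x)
    (hΘ𝔤₁ : Θ ∈ spanC 𝔤₁) (hT₁ : ∀ X ∈ 𝔤₁, ∀ i, Set.MapsTo (X.baseChange ℂ) (T i) (T i))
    (hcomm₂ : ∀ X ∈ 𝔤₂, ∀ a : H.endAlg, X * (a : Module.End ℚ V) = (a : Module.End ℚ V) * X)
    (hT₂ : ∀ X ∈ 𝔤₂, ∀ i, Set.MapsTo (X.baseChange ℂ) (T i) (T i)) {i k : ι}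
    (h : IsBlockConj (realBlocks hint b '' (𝔤₁ : Set (Module.End ℚ V))) i k) :
    IsBlockConj (realBlocks hint b '' (𝔤₂ : Set (Module.End ℚ V))) i k := by
  obtain ⟨g, g', hgg', hg'g, hz⟩ := h
  set gc : Matrix (Fin 2) (Fin 2) ℂ := (algebraMap ℝ ℂ).mapMatrix g with hgc
  set gc' : Matrix (Fin 2) (Fin 2) ℂ := (algebraMap ℝ ℂ).mapMatrix g' with hgc'
  have hg'gc : gc' * gc = 1 := by rw [hgc, hgc', ← map_mul, hg'g, map_one]
  have hggc' : gc * gc' = 1 := by rw [hgc, hgc', ← map_mul, hgg', map_one]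
  -- graph position of the blocks of `𝔤₁`, complexified
  have hrel₁ : ∀ X ∈ 𝔤₁,
      blockMat hint b (X.baseChange ℂ) i * gc = gc * blockMat hint b (X.baseChange ℂ) k := by
    intro X hX
    have h := congrArg (algebraMap ℝ ℂ).mapMatrix (hz _ ⟨X, hX, rfl⟩)
    rw [map_mul, map_mul, RingHom.mapMatrix_apply, RingHom.mapMatrix_apply (algebraMap ℝ ℂ)
      (realBlocks hint b X k), realBlocks_map_apply hint b hb, realBlocks_map_apply hint b hb] at h
    rw [h, Matrix.mul_assoc, Matrix.mul_assoc, ← hgc', hg'gc, Matrix.mul_one]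
  -- the intertwiner commutes with `𝔤₁`, hence lies in `E ⊗ ℂ`, hence commutes with `𝔤₂`
  have hu₁ : ∀ X ∈ 𝔤₁,
      intertwiner hint b i k gc * X.baseChange ℂ = X.baseChange ℂ * intertwiner hint b i k gc :=
    fun X hX => intertwiner_comm hint b i k gc (hT₁ X hX) (hrel₁ X hX)
  have huE := ThetaSubalgebra.mem_span_endAlg_of_forall_commute H 𝔤₁ hΘ hΘ𝔤₁ hu₁
  have hu₂ : ∀ X ∈ 𝔤₂,
      intertwiner hint b i k gc * X.baseChange ℂ = X.baseChange ℂ * intertwiner hint b i k gc :=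
    fun X hX => (GluedBlocks.baseChange_comm_of_mem_span_endAlg H (hcomm₂ X hX) huE).symm
  refine ⟨g, g', hgg', hg'g, ?_⟩
  rintro _ ⟨X, hX, rfl⟩
  have hrel₂ := GluedBlocks.blockMat_mul_eq_mul_blockMat_of_comm hint b i k gc (hT₂ X hX) (hu₂ X hX)
  -- back to real matrices
  apply Matrix.map_injective (algebraMap ℝ ℂ).injective
  change (realBlocks hint b X i).map (algebraMap ℝ ℂ) = (g * realBlocks hint b X k * g').map (algebraMap ℝ ℂ)
  rw [← RingHom.mapMatrix_apply (algebraMap ℝ ℂ) (g * realBlocks hint b X k * g'), map_mul, map_mul,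
    RingHom.mapMatrix_apply (algebraMap ℝ ℂ) (realBlocks hint b X k), realBlocks_map_apply hint b hb,
    realBlocks_map_apply hint b hb, ← hgc, ← hgc', ← hrel₂, Matrix.mul_assoc, hggc', Matrix.mul_one]

/-- **THEOREM (glued real blocks; Hazama 1983 §3 with linked blocks, Moonen–Zarhin 1999 (2.2) Type 2(1),
the Lie step of V. K. Murty 1988 Thm. 2 for `m = 1`).** Let `H` be an effective polarizable `ℚ`-Hodge
structure of weight `1` with polarization `ψ` and Hodge operator `Θ`, and `V_ℂ = ⊕_i T_i` an internal
decomposition into REAL TWO-DIMENSIONAL blocks preserved by every rational operator commuting with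
`E = End_Hdg(V)`, such that an element of `E ⊗ ℂ` preserving all blocks is a scalar on each block, and `E`
has no `ψ`-skew central element. Then there are a class map `cls : ι → ι` (`cls ∘ cls = cls`) and block bases
`b'_i = (b'_i 0 ∈ V^{1,0}, b'_i 1 ∈ V^{0,1})` such that for EVERY bracket-closed rational `𝔤 ⊆ End_ℚ(V)` of
`ψ`-skew operators commuting with `E` with `Θ ∈ 𝔤_ℂ`:
(1) the blocks of every `Y ∈ 𝔤_ℂ` are trace-free;
(2) `blockMat b' Y k = blockMat b' Y k'` whenever `cls k = cls k'` (`Y ∈ 𝔤_ℂ`);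
(3) for every `i` and every trace-free `N`, the operator equal to `N` (in the bases `b'`) on the blocks `k`
with `cls k = cls i` and to `0` on the others lies in `𝔤_ℂ`.
That is, `𝔤_ℂ = ⊕_{classes} 𝔰𝔩₂(ℂ)`, «the i-th component acting on `V_i ⊕ ⋯ ⊕ V_i` diagonally» (Hazama),
for every admissible `𝔤` with the same classes and bases. [cite: Hazama1983, Thm. (1.1), Prop. (2.6), Lemma (3.1) and §3 (pp. 305–306)]
[cite: MoonenZarhin1999LowDim, (2.2) and §3 (3.1)] [cite: Murty1988, Thm. 2 (p. 67)] -/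
theorem GluedBlocks.exists_glued_adapted_blockBasis (H : HodgeStructure V n) (hn : n = 1)
    (heff : H.IsEffective) (ψ : H.Polarization) (hint : DirectSum.IsInternal T)
    (hconjT : ∀ i, ∀ x ∈ T i, conj x ∈ T i) (h2 : ∀ i, Module.finrank ℂ (T i) = 2)
    (hTE : ∀ X : Module.End ℚ V, (∀ a : H.endAlg, X * (a : Module.End ℚ V) = (a : Module.End ℚ V) * X) →
      ∀ i, Set.MapsTo (X.baseChange ℂ) (T i) (T i))
    (hscal : ∀ u ∈ Submodule.span ℂ ((fun a : Module.End ℚ V => a.baseChange ℂ) '' (H.endAlg : Set _)),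
      (∀ i, Set.MapsTo u (T i) (T i)) → ∀ i, ∃ c : ℂ, ∀ x ∈ T i, u x = c • x)
    (hE : ∀ a ∈ H.endAlg, (∀ b ∈ H.endAlg, a * b = b * a) →
      (∀ v w, ψ.form (a v) w + ψ.form v (a w) = 0) → a = 0)
    {Θ : Module.End ℂ (ℂ ⊗[ℚ] V)} (hΘ : ∀ p, ∀ x ∈ H.piece p (n - p), Θ x = ((2 * p - n : ℤ) : ℂ) • x) :
    ∃ (cls : ι → ι) (b' : ∀ i, Module.Basis (Fin 2) ℂ (T i)),
      (∀ i, (b' i 0 : ℂ ⊗[ℚ] V) ∈ H.piece 1 (n - 1)) ∧ (∀ i, (b' i 1 : ℂ ⊗[ℚ] V) ∈ H.piece 0 (n - 0)) ∧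
      (∀ i, cls (cls i) = cls i) ∧
      ∀ (𝔤 : Submodule ℚ (Module.End ℚ V)), (∀ X ∈ 𝔤, ∀ Y ∈ 𝔤, X * Y - Y * X ∈ 𝔤) → Θ ∈ spanC 𝔤 →
        (∀ X ∈ 𝔤, ∀ a : H.endAlg, X * (a : Module.End ℚ V) = (a : Module.End ℚ V) * X) →
        (∀ X ∈ 𝔤, ∀ v w, ψ.form (X v) w + ψ.form v (X w) = 0) →
        (∀ Y ∈ spanC 𝔤, ∀ k, (blockMat hint b' Y k).trace = 0) ∧
        (∀ Y ∈ spanC 𝔤, ∀ k k', cls k = cls k' → blockMat hint b' Y k = blockMat hint b' Y k') ∧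
        (∀ (i : ι) (N : Matrix (Fin 2) (Fin 2) ℂ), N.trace = 0 →
          assemble hint b' (fun k => if cls k = cls i then N else 0) ∈ spanC 𝔤) := by
  classical
  have hfin : ∀ i, Module.Finite ℂ (T i) := fun i => Module.finite_of_finrank_eq_succ (h2 i)
  obtain ⟨b, hb⟩ := GluedBlocks.exists_real_blockBasis hconjT h2
  -- the reference admissible algebra `Lie Hdg(H)`
  set 𝔤₀ : Submodule ℚ (Module.End ℚ V) := H.hodgeLie with h𝔤₀
  have hΘ𝔤₀ : Θ ∈ spanC 𝔤₀ := H.mem_hodgeLieC_of_forall_piece hΘ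
  have hcomm₀ : ∀ X ∈ 𝔤₀, ∀ a : H.endAlg, X * (a : Module.End ℚ V) = (a : Module.End ℚ V) * X :=
    fun X hX a => H.commute_of_mem_hodgeLie hX a
  have hT₀ : ∀ X ∈ 𝔤₀, ∀ i, Set.MapsTo (X.baseChange ℂ) (T i) (T i) := fun X hX => hTE X (hcomm₀ X hX)
  have hΘT : ∀ i, Set.MapsTo Θ (T i) (T i) := fun i =>
    mapsTo_of_mem_spanC (T := T i) (fun X hX => hT₀ X hX i) hΘ𝔤₀
  -- conjugacy classes of the real blocks of `𝔤₀`
  set S₀ : Set (ι → Matrix (Fin 2) (Fin 2) ℝ) := realBlocks hint b '' (𝔤₀ : Set (Module.End ℚ V)) with hS₀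
  let r : Setoid ι := ⟨fun i k => IsBlockConj S₀ i k,
    ⟨isBlockConj_refl S₀, fun h => h.symm, fun h₁ h₂ => h₁.trans h₂⟩⟩
  let cls : ι → ι := fun i => (Quotient.mk r i).out
  have hcls_iff : ∀ k k', cls k = cls k' ↔ IsBlockConj S₀ k k' := by
    intro k k'
    constructor
    · intro h
      have h1 : Quotient.mk r k = Quotient.mk r k' := by
        rw [← Quotient.out_eq (Quotient.mk r k), ← Quotient.out_eq (Quotient.mk r k')]
        exact congrArg (Quotient.mk r) h
      exact Quotient.exact h1
    · intro h
      exact congrArg Quotient.out (Quotient.sound (s := r) h)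
  have hcls_rel : ∀ k, IsBlockConj S₀ (cls k) k := fun k =>
    Quotient.exact (Quotient.out_eq (Quotient.mk r k))
  have hcls_idem : ∀ i, cls (cls i) = cls i := fun i => (hcls_iff (cls i) i).2 (hcls_rel i)
  -- gluing matrices and intertwiners `u_k : T_{cls k} → T_k`
  choose g g' hgg' hg'g hzS using hcls_rel
  set gc : ι → Matrix (Fin 2) (Fin 2) ℂ := fun k => (algebraMap ℝ ℂ).mapMatrix (g' k) with hgc
  set gcc : ι → Matrix (Fin 2) (Fin 2) ℂ := fun k => (algebraMap ℝ ℂ).mapMatrix (g k) with hgcc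
  have hgc_inv : ∀ k, gc k * gcc k = 1 := fun k => by
    simp only [hgc, hgcc]; rw [← map_mul, hg'g, map_one]
  have hgc_inv' : ∀ k, gcc k * gc k = 1 := fun k => by
    simp only [hgc, hgcc]; rw [← map_mul, hgg', map_one]
  have hrel₀ : ∀ k, ∀ X ∈ 𝔤₀,
      blockMat hint b (X.baseChange ℂ) k * gc k = gc k * blockMat hint b (X.baseChange ℂ) (cls k) := by
    intro k X hX
    have h := congrArg (algebraMap ℝ ℂ).mapMatrix (hzS k _ ⟨X, hX, rfl⟩)
    rw [map_mul, map_mul, RingHom.mapMatrix_apply, RingHom.mapMatrix_apply (algebraMap ℝ ℂ)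
      (realBlocks hint b X k), realBlocks_map_apply hint b hb, realBlocks_map_apply hint b hb] at h
    -- h : blockMat (cls k) = gcc k * blockMat k * gc k
    have h' : gc k * blockMat hint b (X.baseChange ℂ) (cls k) =
        blockMat hint b (X.baseChange ℂ) k * gc k := by
      rw [h]
      change gc k * (gcc k * blockMat hint b (X.baseChange ℂ) k * gc k) = _
      rw [← Matrix.mul_assoc, ← Matrix.mul_assoc, hgc_inv, Matrix.one_mul]
    exact h'.symm
  set u : ι → Module.End ℂ (ℂ ⊗[ℚ] V) := fun k => intertwiner hint b k (cls k) (gc k) with hu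
  have hu₀ : ∀ k, ∀ X ∈ 𝔤₀, u k * X.baseChange ℂ = X.baseChange ℂ * u k :=
    fun k X hX => intertwiner_comm hint b k (cls k) (gc k) (hT₀ X hX) (hrel₀ k X hX)
  have huE : ∀ k, u k ∈ Submodule.span ℂ ((fun a : Module.End ℚ V => a.baseChange ℂ) '' (H.endAlg : Set _)) :=
    fun k => ThetaSubalgebra.mem_span_endAlg_of_forall_commute H 𝔤₀ hΘ hΘ𝔤₀ (hu₀ k)
  have humaps : ∀ k, ∀ x ∈ T (cls k), u k x ∈ T k := fun k x hx =>
    intertwiner_mapsTo hint b k (cls k) (gc k) hx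
  -- the restrictions `T_{cls k} ≃ T_k`
  have hequiv : ∀ k, ∃ e : T (cls k) ≃ₗ[ℂ] T k, ∀ x : T (cls k), (e x : ℂ ⊗[ℚ] V) = u k x := by
    intro k
    haveI := hfin k
    haveI := hfin (cls k)
    set uR : T (cls k) →ₗ[ℂ] T k := (u k).restrict (p := T (cls k)) (q := T k) (humaps k) with huR
    have huR_apply : ∀ x : T (cls k), (uR x : ℂ ⊗[ℚ] V) = u k x := fun x => rfl
    have hinj : Function.Injective uR := by
      rw [← LinearMap.ker_eq_bot, Submodule.eq_bot_iff]
      intro x hx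
      rw [LinearMap.mem_ker] at hx
      have hx0 : u k (x : ℂ ⊗[ℚ] V) = 0 := by rw [← huR_apply, hx]; rfl
      -- coordinates of `x` in the real basis of `T_{cls k}`
      have hxsum : (x : ℂ ⊗[ℚ] V) = ∑ c, (b (cls k)).repr x c • (b (cls k) c : ℂ ⊗[ℚ] V) := by
        conv_lhs => rw [← (b (cls k)).sum_repr x]
        simp only [Submodule.coe_sum, Submodule.coe_smul]
      have hux : u k (x : ℂ ⊗[ℚ] V) = ∑ a, (∑ c, gc k a c * (b (cls k)).repr x c) • (b k a : ℂ ⊗[ℚ] V) := by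
        rw [hxsum, map_sum]
        simp_rw [map_smul, hu, intertwiner_apply_same, Finset.smul_sum, smul_smul]
        rw [Finset.sum_comm]
        refine Finset.sum_congr rfl fun a _ => ?_
        rw [Finset.sum_smul]
        exact Finset.sum_congr rfl fun c _ => by rw [mul_comm]
      have hli : LinearIndependent ℂ fun a => (b k a : ℂ ⊗[ℚ] V) :=
        (b k).linearIndependent.map' (T k).subtype (Submodule.ker_subtype _)
      rw [hux] at hx0
      have hcoef : ∀ a, ∑ c, gc k a c * (b (cls k)).repr x c = 0 :=
        fun a => Fintype.linearIndependent_iff.1 hli _ hx0 a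
      -- `gc k *ᵥ v = 0` with `gc k` invertible forces `v = 0`
      have hv : ∀ c, (b (cls k)).repr x c = 0 := by
        intro c
        have h1 : ((gcc k * gc k).mulVec fun c => (b (cls k)).repr x c) c = 0 := by
          rw [← Matrix.mulVec_mulVec]
          have hz : (gc k).mulVec (fun c => (b (cls k)).repr x c) = 0 := by
            funext a; exact hcoef a
          rw [hz, Matrix.mulVec_zero, Pi.zero_apply]
        rwa [hgc_inv', Matrix.one_mulVec] at h1
      have : x = 0 := by
        apply (b (cls k)).repr.injective
        ext c
        rw [hv c, map_zero, Finsupp.zero_apply]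
      exact this
    exact ⟨uR.linearEquivOfInjective hinj (by rw [h2, h2]), fun x => rfl⟩
  choose e he using hequiv
  -- raw adapted bases and the glued bases
  obtain ⟨b0, hb0, hb1⟩ := GluedBlocks.exists_adapted_blockBasis H hn heff hconjT hΘ hΘT h2
  let b' : ∀ i, Module.Basis (Fin 2) ℂ (T i) := fun k => (b0 (cls k)).map (e k)
  have hb'_apply : ∀ k c, (b' k c : ℂ ⊗[ℚ] V) = u k (b0 (cls k) c) := fun k c => by
    change (((b0 (cls k)).map (e k)) c : ℂ ⊗[ℚ] V) = _
    rw [Module.Basis.map_apply, he]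
  refine ⟨cls, b', fun k => ?_, fun k => ?_, hcls_idem, fun 𝔤 hbr hΘ𝔤 hcomm hskew => ?_⟩
  · rw [hb'_apply]; exact GluedBlocks.apply_mem_piece_of_mem_span_endAlg H (huE k) (hb0 (cls k))
  · rw [hb'_apply]; exact GluedBlocks.apply_mem_piece_of_mem_span_endAlg H (huE k) (hb1 (cls k))
  -- an admissible algebra `𝔤`
  have hT : ∀ X ∈ 𝔤, ∀ i, Set.MapsTo (X.baseChange ℂ) (T i) (T i) := fun X hX => hTE X (hcomm X hX)
  have hYT : ∀ Y ∈ spanC 𝔤, ∀ j, Set.MapsTo Y (T j) (T j) := fun Y hY j =>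
    mapsTo_of_mem_spanC (T := T j) (fun X hX => hT X hX j) hY
  have huY : ∀ Y ∈ spanC 𝔤, ∀ k, u k * Y = Y * u k := fun Y hY k =>
    commute_of_mem_spanC (fun X hX => (GluedBlocks.baseChange_comm_of_mem_span_endAlg H (hcomm X hX) (huE k)).symm)
      hY
  -- (2) the gluing: the `k`-th block in `b'` is the `cls k`-th block in the raw adapted bases
  have hglue : ∀ Y ∈ spanC 𝔤, ∀ k, blockMat hint b' Y k = blockMat hint b0 Y (cls k) := by
    intro Y hY k
    ext a c
    rw [blockMat_apply_of_mapsTo hint b' (hYT Y hY), blockMat_apply_of_mapsTo hint b0 (hYT Y hY)]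
    have hYu : Y (u k (b0 (cls k) c)) = u k (Y (b0 (cls k) c)) := by
      rw [← Module.End.mul_apply, ← huY Y hY k, Module.End.mul_apply]
    have hval : (⟨Y (b' k c), hYT Y hY k (b' k c).2⟩ : T k) =
        e k ⟨Y (b0 (cls k) c), hYT Y hY (cls k) (b0 (cls k) c).2⟩ := by
      apply Subtype.ext
      rw [he]
      change Y (b' k c) = u k (Y (b0 (cls k) c))
      rw [hb'_apply, hYu]
    rw [hval]
    change ((b0 (cls k)).map (e k)).repr (e k _) a = _
    rw [Module.Basis.map_repr, LinearEquiv.trans_apply, LinearEquiv.symm_apply_apply]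
  refine ⟨fun Y hY k => GluedBlocks.trace_blockMat_eq_zero_of_mem_spanC H hn heff ψ hint b' 𝔤 hbr hΘ hΘ𝔤
      hcomm hskew hT hE hY k, fun Y hY k k' hkk' => by rw [hglue Y hY k, hglue Y hY k', hkk'], ?_⟩
  -- (3) reaching a class
  intro i N hN
  set Q : Matrix (Fin 2) (Fin 2) ℂ := (b' i).toMatrix (b i) with hQ
  set Q' : Matrix (Fin 2) (Fin 2) ℂ := (b i).toMatrix (b' i) with hQ'
  have hQQ' : Q * Q' = 1 := (b' i).toMatrix_mul_toMatrix_flip (b i)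
  have hQ'Q : Q' * Q = 1 := (b i).toMatrix_mul_toMatrix_flip (b' i)
  have hN₀ : (Q' * N * Q).trace = 0 := by
    rw [Matrix.trace_mul_cycle, hQQ', Matrix.one_mul, hN]
  obtain ⟨Y, hY, hYT', hYi, hYk⟩ := GluedBlocks.exists_mem_spanC_blockMat_eq H hn heff ψ hint b hb hscal 𝔤 hbr
    hΘ hΘ𝔤 hcomm hskew hT hE i (Q' * N * Q) hN₀
  have hblk : blockMat hint b' Y = fun k => if cls k = cls i then N else 0 := by
    funext k
    by_cases hk : cls k = cls i
    · rw [if_pos hk, hglue Y hY k, hk, ← hglue Y hY i,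
        GluedBlocks.blockMat_eq_conj_blockMat hint b b' hYT' i, hYi, ← hQ, ← hQ']
      calc Q * (Q' * N * Q) * Q' = (Q * Q') * N * (Q * Q') := by simp only [Matrix.mul_assoc]
        _ = N := by rw [hQQ', Matrix.one_mul, Matrix.mul_one]
    · rw [if_neg hk]
      have hki : k ≠ i := fun h => hk (by rw [h])
      have hnc₀ : ¬ IsBlockConj S₀ i k := fun h => hk ((hcls_iff i k).2 h).symm
      have hnc : ¬ IsBlockConj (realBlocks hint b '' (𝔤 : Set (Module.End ℚ V))) i k := fun h =>
        hnc₀ (GluedBlocks.isBlockConj_of_isBlockConj H hint b hb 𝔤 𝔤₀ hΘ hΘ𝔤 hT hcomm₀ hT₀ h)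
      have h0 := hYk k hki hnc
      exact GluedBlocks.blockMat_eq_zero_of_forall_apply hint b' hYT' fun x hx =>
        GluedBlocks.apply_eq_zero_of_blockMat_eq_zero hint b hYT' h0 hx
  rw [← hblk, assemble_blockMat hint b' hYT']
  exact hY

end Glued

end HodgeStructure

end Literature.AlgebraicGeometry.Motives

end
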